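import Literature.AlgebraicGeometry.Pohlmann1968.HodgeClassesCMType
import Literature.FieldTheory.AlgClosed.AutomorphismExtension
import HarnessLib

/-!
# Galois descent for an `Aut(ℂ)`-stable family of eigenvectors of a rational operator, LOCATING the
# rational classes: `span {b_t : t ∈ B}` is spanned by the rational classes it contains

A proofs-only companion (theorems only, no definitions, no named facts) of
`Pohlmann1968/HodgeClassesCMType` (`Pohlmann1968.monomial_mem_span_of_stable`, the `⊇` half of Pohlmann's
theorem by Galois descent).  That lemma concludes that a cup monomial of a Galois-stable family of type `(p, q)`
monomials is a combination of rational `(p, q)`-classes of the AMBIENT `Hᵈ(X(ℂ); ℂ)`; the present TYPE-FREE form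
keeps track of WHERE the rational classes live — inside the span of the family itself — which is what one needs
to exhibit a `ℚ`-structure on a specific subspace (consumer: the `ℚ`-structure `⋀^{2m}_K H¹(B, ℚ)` of Deligne's
Weil space, `Summits/HodgeConjecture/CorCM/WeilLineClassesRationalStructure`).

Statement (`span_image_le_span_isRationalClass_of_stable`).  Let `X` be smooth projective, `b` a basis of
`Hᵈ(X(ℂ); ℂ)` in which a rationality-preserving operator `φ` (e.g. `f^*` for a morphism `f`) is diagonal with
eigenvalues `e_t ∈ ℂ`; let `Aut(ℂ)` act on the index set by injections `g_τ` with `τ(e_t) = e_{g_τ t}`; let `B` be a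
`g`-stable set of indices whose eigenvalues differ from the eigenvalues outside `B`.  Then
`span {b_t : t ∈ B} ⊆ span {c rational | c ∈ span {b_t : t ∈ B}}`.

Mechanism — T. A. Springer, *Linear Algebraic Groups* (2nd ed. 1998) **Prop. 11.1.4** "A subspace `W` of `V` is
defined over `F` if and only if `Γ.W = W`" (held: `book:springer1998-linear-algebraic-groups`, chunks
p0202–p0203), in the carriers' language and with `Γ = Aut(ℂ)` replaced by its action on eigenvalues: the
polynomials `q = ∏_{t∈B}(X − e_t)` and `r = ∏_{t∉B}(X − e_t)` have `Aut(ℂ)`-fixed, hence RATIONAL, coefficients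
(the fixed field of `Aut(ℂ)` is `ℚ`: the tree's `Complex.isIntegral_of_forall_ringEquiv_mem`,
`Complex.natDegree_minpoly_le_card`) and are coprime; with `a q + c r = 1` in `ℚ[X]` the operator `Pr = (c r)(φ)`
is a `ℚ`-polynomial in the rational operator `φ`, hence preserves rational classes, is the identity on
`span {b_t : t ∈ B}` and kills the other `b_t`; since `Hᵈ(X(ℂ); ℂ)` is spanned by rational classes
(`span_isRationalClass_eq_top_of_isSmoothProjective_holds`), `span {b_t : t ∈ B} = Pr(Hᵈ)` is spanned by the
rational classes `Pr(r)`, which lie in it.  This is the argument of [GaoUllmo2025, proof of Thm. 3.1] ("`[σP] ∈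
B^p ⊗ ℂ` for each `σ`"), as already formalised in the Pohlmann file, minus the Hodge-type bookkeeping.

References: [SpringerLAG1998] T. A. Springer, *Linear Algebraic Groups*, 2nd ed. (1998), §11.1.3–11.1.5;
[GaoUllmo2025] Z. Gao, E. Ullmo, J. Inst. Math. Jussieu 25 (2025), proof of Thm. 3.1; [Cox2013] D. A. Cox,
*Galois Theory*, 2nd ed., §10.C (conjugates under `Aut(ℂ)`); [Borel1991] A. Borel, *Linear Algebraic Groups*,
AG §14.2 (`k`-structures on vector spaces).
-/

noncomputable section

namespace Literature.AlgebraicGeometry.HodgeTheory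

open Polynomial Module
open Literature.AlgebraicTopology.SingularHomology
open Literature.AlgebraicGeometry.Motives (IsSmoothProjective SchemeOver)

/-- A `ℚ`-polynomial in a rationality-preserving operator preserves rational classes (the Pohlmann file's
private helper, re-proved: induction on the polynomial, `IsRationalClass.add/.smul`). [cite: SpringerLAG1998, §11.1.5] -/
private theorem isRationalClass_aeval_map_rat {Y : Type} [TopologicalSpace Y] {k : ℕ}
    (φ : Module.End ℂ (singularCohomology ℂ ℂ Y k))
    (hφ : ∀ ⦃x : singularCohomology ℂ ℂ Y k⦄, IsRationalClass x → IsRationalClass (φ x))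
    (P : ℚ[X]) {x : singularCohomology ℂ ℂ Y k} (hx : IsRationalClass x) :
    IsRationalClass (aeval φ (P.map (algebraMap ℚ ℂ)) x) := by
  induction P using Polynomial.induction_on' with
  | add p q hp hq =>
    rw [Polynomial.map_add, map_add, LinearMap.add_apply]
    exact hp.add hq
  | monomial n a =>
    rw [Polynomial.map_monomial, aeval_monomial, Module.End.mul_apply, eq_ratCast,
      Module.algebraMap_end_apply]
    refine IsRationalClass.smul ?_ a
    induction n with
    | zero => simpa using hx
    | succ n ih => rw [pow_succ', Module.End.mul_apply]; exact hφ ih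

/-- A complex number fixed by every automorphism of `ℂ` is rational (the fixed field of `Aut(ℂ)` is `ℚ`:
its `Aut(ℂ)`-orbit is `{x}`, so `x` is algebraic with all conjugates equal to `x`, `deg minpoly_ℚ(x) = 1`;
the Pohlmann file's private helper, re-proved from the tree's `Complex.isIntegral_of_forall_ringEquiv_mem` and
`Complex.natDegree_minpoly_le_card`). [cite: Cox2013, §10.C proof of Thm. 10.23] -/
private theorem mem_range_algebraMap_rat_of_forall_ringEquiv_apply {x : ℂ}
    (h : ∀ τ : ℂ ≃+* ℂ, (τ : ℂ →+* ℂ) x = x) : x ∈ Set.range (algebraMap ℚ ℂ) := by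
  classical
  have hmem : ∀ σ : ℂ ≃+* ℂ, σ x ∈ ({x} : Finset ℂ) := fun σ => by
    rw [Finset.mem_singleton]; exact h σ
  have hint : IsIntegral ℚ x :=
    Literature.FieldTheory.AlgClosed.Complex.isIntegral_of_forall_ringEquiv_mem
      (Finset.finite_toSet {x}) (by simpa using hmem)
  have hle : (minpoly ℚ x).natDegree ≤ 1 := by
    simpa using Literature.FieldTheory.AlgClosed.Complex.natDegree_minpoly_le_card hmem
  have hge : 0 < (minpoly ℚ x).natDegree := minpoly.natDegree_pos hint
  have hdeg : (minpoly ℚ x).degree = 1 := by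
    rw [degree_eq_natDegree (minpoly.ne_zero hint)]
    exact_mod_cast le_antisymm hle hge
  obtain ⟨q, hq⟩ := minpoly.mem_range_of_degree_eq_one ℚ x hdeg
  exact ⟨q, hq⟩

/-- **Galois descent for an `Aut(ℂ)`-stable family of eigenvectors of a rational operator, locating the rational
classes** (Springer 11.1.4 "a subspace `W` of `V` is defined over `F` iff `Γ.W = W`", in the tree's carrier
language; the type-free form of `Pohlmann1968.monomial_mem_span_of_stable`).  Let `b` be a basis of `Hᵈ(Z(ℂ); ℂ)`
(`Z` smooth projective) in which a rationality-preserving operator `φ` is diagonal with eigenvalues `e_t`, let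
`Aut(ℂ)` act on the index set by injections `g_τ` with `τ(e_t) = e_{g_τ t}`, and let `B` be a `g`-stable set of
indices whose eigenvalues differ from those outside `B`.  Then `span {b_t : t ∈ B}` is spanned by the RATIONAL
classes it contains: `q = ∏_{t∈B}(X − e_t)` and `r = ∏_{t∉B}(X − e_t)` have `Aut(ℂ)`-fixed, hence rational,
coefficients and are coprime; with `a q + c r = 1` in `ℚ[X]` the operator `Pr = (c r)(φ)` is a rationality-preserving
projector onto `span {b_t : t ∈ B}`, and `Hᵈ` is spanned by rational classes
(`span_isRationalClass_eq_top_of_isSmoothProjective_holds`). [cite: SpringerLAG1998, Prop. 11.1.4]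
[cite: GaoUllmo2025, proof of Thm. 3.1] -/
theorem span_image_le_span_isRationalClass_of_stable {Z : SchemeOver ℂ} {g d : ℕ}
    (hZ : IsSmoothProjective g Z) {T : Type} [Fintype T] [DecidableEq T]
    (b : Module.Basis T ℂ (complexBetti Z d)) (φ : Module.End ℂ (complexBetti Z d))
    (hφrat : ∀ ⦃x : complexBetti Z d⦄, IsRationalClass x → IsRationalClass (φ x))
    (e : T → ℂ) (hφb : ∀ t, φ (b t) = e t • b t)
    (gp : (ℂ ≃+* ℂ) → T → T) (hginj : ∀ τ, Function.Injective (gp τ))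
    (hg : ∀ (τ : ℂ ≃+* ℂ) (t : T), (τ : ℂ →+* ℂ) (e t) = e (gp τ t))
    (B : Finset T) (hBs : ∀ τ, ∀ t ∈ B, gp τ t ∈ B)
    (hsep : ∀ t ∈ B, ∀ t', t' ∉ B → e t ≠ e t') :
    Submodule.span ℂ (b '' ↑B) ≤
      Submodule.span ℂ {c : complexBetti Z d | IsRationalClass c ∧ c ∈ Submodule.span ℂ (b '' ↑B)} := by
  classical
  -- `B` and its complement are permuted by every `gp τ`
  have hgB : ∀ τ, B.map ⟨gp τ, hginj τ⟩ = B := fun τ =>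
    Finset.eq_of_subset_of_card_le
      (fun x hx => by
        obtain ⟨y, hy, rfl⟩ := Finset.mem_map.1 hx
        exact hBs τ y hy)
      (by rw [Finset.card_map])
  have hgBc : ∀ τ, (Finset.univ \ B).map ⟨gp τ, hginj τ⟩ = Finset.univ \ B := fun τ =>
    Finset.eq_of_subset_of_card_le
      (fun x hx => by
        obtain ⟨y, hy, rfl⟩ := Finset.mem_map.1 hx
        rw [Finset.mem_sdiff] at hy ⊢
        refine ⟨Finset.mem_univ _, fun hyB => hy.2 ?_⟩
        rw [← hgB τ] at hyB
        obtain ⟨z, hz, hzy⟩ := Finset.mem_map.1 hyB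
        rwa [← hginj τ hzy])
      (by rw [Finset.card_map])
  -- `Aut(ℂ)`-invariant products of linear factors have rational coefficients
  have hprodfix : ∀ (S : Finset T) (τ : ℂ ≃+* ℂ), S.map ⟨gp τ, hginj τ⟩ = S →
      (∏ t ∈ S, (X - C (e t))).map (τ : ℂ →+* ℂ) = ∏ t ∈ S, (X - C (e t)) := by
    intro S τ hS
    rw [Polynomial.map_prod]
    simp only [Polynomial.map_sub, Polynomial.map_X, Polynomial.map_C, hg]
    conv_rhs => rw [← hS, Finset.prod_map]
    rfl
  have hlift : ∀ S : Finset T, (∀ τ, S.map ⟨gp τ, hginj τ⟩ = S) →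
      ∃ P₀ : ℚ[X], P₀.map (algebraMap ℚ ℂ) = ∏ t ∈ S, (X - C (e t)) := by
    intro S hS
    rw [← Polynomial.mem_lifts, Polynomial.lifts_iff_coeff_lifts]
    intro n
    apply mem_range_algebraMap_rat_of_forall_ringEquiv_apply
    intro τ
    rw [← Polynomial.coeff_map, hprodfix S τ (hS τ)]
  obtain ⟨q₀, hq₀⟩ := hlift B hgB
  obtain ⟨r₀, hr₀⟩ := hlift (Finset.univ \ B) hgBc
  -- `q₀`, `r₀` are coprime: their roots `e t`, `t ∈ B` / `t ∉ B`, are disjoint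
  have hcop : IsCoprime q₀ r₀ := by
    rw [← Polynomial.isCoprime_map (algebraMap ℚ ℂ), hq₀, hr₀]
    refine IsCoprime.prod_left fun t ht => IsCoprime.prod_right fun t' ht' => ?_
    apply Polynomial.isCoprime_X_sub_C_of_isUnit_sub
    rw [Finset.mem_sdiff] at ht'
    exact (sub_ne_zero.2 (hsep t ht t' ht'.2)).isUnit
  obtain ⟨a₀, c₀, hac⟩ := hcop
  -- the rational projector `Pr = (c₀ r₀)(φ)` onto `span (b '' B)`
  set Pr : Module.End ℂ (complexBetti Z d) := aeval φ ((c₀ * r₀).map (algebraMap ℚ ℂ)) with hPr_def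
  have hPrb : ∀ t, Pr (b t) = ((c₀ * r₀).map (algebraMap ℚ ℂ)).eval (e t) • b t := fun t =>
    Module.End.aeval_apply_of_hasEigenvector ⟨Module.End.mem_eigenspace_iff.2 (hφb t), b.ne_zero t⟩
  have hQroot : ∀ t ∈ B, (q₀.map (algebraMap ℚ ℂ)).eval (e t) = 0 := fun t ht => by
    rw [hq₀, Polynomial.eval_prod]
    exact Finset.prod_eq_zero ht (by simp)
  have hRroot : ∀ t ∈ Finset.univ \ B, (r₀.map (algebraMap ℚ ℂ)).eval (e t) = 0 := fun t ht => by
    rw [hr₀, Polynomial.eval_prod]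
    exact Finset.prod_eq_zero ht (by simp)
  have hPrB : ∀ t ∈ B, Pr (b t) = b t := fun t ht => by
    rw [hPrb]
    have h1 : ((c₀ * r₀).map (algebraMap ℚ ℂ)).eval (e t) = 1 := by
      have h := congrArg (fun P₀ : ℚ[X] => (P₀.map (algebraMap ℚ ℂ)).eval (e t)) hac
      simpa only [Polynomial.map_add, Polynomial.map_mul, Polynomial.eval_add,
        Polynomial.eval_mul, hQroot t ht, mul_zero, zero_add, Polynomial.map_one,
        Polynomial.eval_one] using h
    rw [h1, one_smul]
  have hPrB' : ∀ t, t ∉ B → Pr (b t) = 0 := fun t ht => by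
    rw [hPrb, Polynomial.map_mul, Polynomial.eval_mul,
      hRroot t (Finset.mem_sdiff.2 ⟨Finset.mem_univ _, ht⟩), mul_zero, zero_smul]
  have hPrrat : ∀ x : complexBetti Z d, IsRationalClass x → IsRationalClass (Pr x) :=
    fun x hx => isRationalClass_aeval_map_rat φ hφrat _ hx
  -- `Pr` maps `Hᵈ` into `span (b '' B)` and fixes `span (b '' B)` pointwise
  have hPrmem : ∀ x, Pr x ∈ Submodule.span ℂ (b '' ↑B) := by
    intro x
    rw [← b.sum_repr x, map_sum]
    refine Submodule.sum_mem _ fun t _ => ?_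
    rw [map_smul]
    by_cases htB : t ∈ B
    · rw [hPrB t htB]
      exact Submodule.smul_mem _ _ (Submodule.subset_span ⟨t, htB, rfl⟩)
    · rw [hPrB' t htB, smul_zero]
      exact Submodule.zero_mem _
  have hPrid : ∀ y ∈ Submodule.span ℂ (b '' ↑B), Pr y = y := by
    intro y hy
    induction hy using Submodule.span_induction with
    | mem z hz =>
      obtain ⟨t, ht, rfl⟩ := hz
      exact hPrB t ht
    | zero => exact map_zero _
    | add z z' _ _ hz hz' => rw [map_add, hz, hz']
    | smul a z _ hz => rw [map_smul, hz]
  -- every value of `Pr` is a combination of rational classes in `span (b '' B)`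
  have key : ∀ x, Pr x ∈ Submodule.span ℂ
      {c : complexBetti Z d | IsRationalClass c ∧ c ∈ Submodule.span ℂ (b '' ↑B)} := by
    intro x
    have hx : x ∈ Submodule.span ℂ {c : complexBetti Z d | IsRationalClass c} := by
      rw [span_isRationalClass_eq_top_of_isSmoothProjective_holds g Z hZ d]; exact Submodule.mem_top
    induction hx using Submodule.span_induction with
    | mem y hy => exact Submodule.subset_span ⟨hPrrat y hy, hPrmem y⟩
    | zero => rw [map_zero]; exact Submodule.zero_mem _
    | add y z _ _ hy hz => rw [map_add]; exact Submodule.add_mem _ hy hz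
    | smul a y _ hy => rw [map_smul]; exact Submodule.smul_mem _ a hy
  intro y hy
  rw [← hPrid y hy]
  exact key y

/-- The equality form: `span {b_t : t ∈ B} = span {c rational | c ∈ span {b_t : t ∈ B}}` — the subspace is DEFINED
OVER `ℚ` in the sense of the carriers. [cite: SpringerLAG1998, Prop. 11.1.4] -/
theorem span_image_eq_span_isRationalClass_of_stable {Z : SchemeOver ℂ} {g d : ℕ}
    (hZ : IsSmoothProjective g Z) {T : Type} [Fintype T] [DecidableEq T]
    (b : Module.Basis T ℂ (complexBetti Z d)) (φ : Module.End ℂ (complexBetti Z d))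
    (hφrat : ∀ ⦃x : complexBetti Z d⦄, IsRationalClass x → IsRationalClass (φ x))
    (e : T → ℂ) (hφb : ∀ t, φ (b t) = e t • b t)
    (gp : (ℂ ≃+* ℂ) → T → T) (hginj : ∀ τ, Function.Injective (gp τ))
    (hg : ∀ (τ : ℂ ≃+* ℂ) (t : T), (τ : ℂ →+* ℂ) (e t) = e (gp τ t))
    (B : Finset T) (hBs : ∀ τ, ∀ t ∈ B, gp τ t ∈ B)
    (hsep : ∀ t ∈ B, ∀ t', t' ∉ B → e t ≠ e t') :
    Submodule.span ℂ (b '' ↑B) =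
      Submodule.span ℂ {c : complexBetti Z d | IsRationalClass c ∧ c ∈ Submodule.span ℂ (b '' ↑B)} :=
  le_antisymm (span_image_le_span_isRationalClass_of_stable hZ b φ hφrat e hφb gp hginj hg B hBs hsep)
    (Submodule.span_le.2 fun _ hc => hc.2)

end Literature.AlgebraicGeometry.HodgeTheory

end
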